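import Literature.Computability.QuantumComplexity.PhaseQueryOps
import HarnessLib

/-!
# Phase-query families, II: parameters, layout, the program and the circuit family

Second file of the construction of a uniform Clifford+`T` family for explicit `k`-fold FORRELATION
(`AaronsonAmbainis2018_kForrelation_mem`; Aaronson–Ambainis, SIAM J. Comput. 47 (2018), §6,
Prop. 6 with §3.2: `⌈k/2⌉`-query algorithm; in the white-box setting each query is a run of the
given circuit). The family is generic in a **phase machine**: one polynomial-time string function
`Fn` (given by a machine `M` with time exponent `e`) which, reading the whole classical prefix of
the register followed by the constant suffix `vg N` of `CWrapLayout.lean` and a two-bit *mode*,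
answers in unary

* mode `W` (`00`): the number `W` of *active query wires* (output `1^W`),
* mode `K` (`10`): the number `K` of *active Hadamard layers* (output `1^K`),
* mode `P` (`01`): the phase bit of layer `j` on the register of copy `c` (output `[] ↔` sign `−1`),
* mode `Z` (`11`): whether some copy returned to `|0…0⟩` (output `≠ [] ↔` yes).

Only the *emptiness* result wires of the garbage-free block (`RevClean.cleanOps`; they read
`[|out| ≤ j]`, `CWrapLayout.outBit_none_eq`) are ever used, so nothing depends on the internal
alphabet of `M`.

Layout at input length `N` (`Wq = N + cW` query wires per copy, `Ly = N + cL` phase layers):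
input `x` on `[0, N)`, three query registers `qW c t`, the unary layer register `jW i`, the copy
code `cw i` and the mode `mw i` (two bits each) — the `D N` *data* wires of the one clean block
`blk`, whose work wires follow up to `Wblk N` —, and *above the block* (so that the block neither
reads nor writes them, `RevUncompute.clEval_ite`) the masks `MW t` (`= [t < W]`) and `KW j`
(`= [j < K]`), the control ancilla `aW` and the answer flag `oW`. The program `allOps`: compute the two masks
(block, copy the emptiness wires, block again — the block is an involution,
`RevClean.clEval_cleanOps_cleanOps`), then for every layer a masked Hadamard layer on each copy
(`Toffoli (KW j) (MW t) aW`, `CH aW (qW c t)`, Toffoli) followed by the three phase macros (write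
layer and copy, block, `Z` on the emptiness wire of cell `0`, block, unwrite), a last Hadamard
layer, the zero test (mode `Z`, block, copy and negate cell `0` into `oW`, block) and the swap of
`oW` with wire `0`. This file is syntax and bounds only: `Params`, the layout with its injectivity
and range facts, the programs, their well-formedness and wire bounds, the compiled circuit
`bigCirc` and the family `family`.

## References

* S. Aaronson, A. Ambainis, *Forrelation*, SIAM J. Comput. 47 (2018), §3.2 (Fig. 2), §6 (p. 26,
  Prop. 6) [AaronsonAmbainis2018].
* M. A. Nielsen, I. L. Chuang, *Quantum Computation and Quantum Information*, CUP 2010, §3.2.5,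
  §4.3, §6.1.1 [NielsenChuang2010].
* E. Bernstein, U. Vazirani, *Quantum complexity theory*, SIAM J. Comput. 26 (1997), §8
  (classical computation inside quantum machines) [BernsteinVazirani1997].
-/

noncomputable section

namespace Literature.Computability.QuantumComplexity

open _root_.Computability Complexity Cryptography Matrix Finset RevSim RevClean RazTalMachine Turing

namespace PhaseQuery

/-! ### Parameters -/

/-- **Parameters of a phase-query family**: the numbers `cW`, `cL` of extra query wires and extra
layers (`Wq = N + cW`, `Ly = N + cL` at input length `N`), and the phase machine `M` with time
exponent `e` computing the mode-multiplexed string function `Fn` (see the module docstring).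
[cite: AaronsonAmbainis2018, §6 (p. 26)] -/
structure Params where
  /-- extra query wires per copy -/
  cW : ℕ
  /-- extra phase layers -/
  cL : ℕ
  /-- the mode-multiplexed phase/mask/zero-test function -/
  Fn : List Bool → List Bool
  /-- time exponent of the machine -/
  e : ℕ
  /-- the machine -/
  M : TM2ComputableAux Bool Bool
  /-- it computes `Fn` within `(n+2)^e` steps -/
  hM : ∀ u, M.OutputsWithin u (Fn u) (Tn e u.length)

variable (P : Params)

/-! ### Layout -/

section Layout

variable (N : ℕ)

/-- Query wires per copy. [folklore] -/
def Wq : ℕ := N + P.cW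
/-- Phase layers. [folklore] -/
def Ly : ℕ := N + P.cL
/-- Query wire `t` of copy `c`. [folklore] -/
def qW (c t : ℕ) : ℕ := N + c * Wq P N + t
/-- Bit `i` of the unary layer register. [folklore] -/
def jW (i : ℕ) : ℕ := N + 3 * Wq P N + i
/-- Bit `i < 2` of the copy code. [folklore] -/
def cw (i : ℕ) : ℕ := N + 3 * Wq P N + Ly P N + i
/-- Bit `i < 2` of the mode. [folklore] -/
def mw (i : ℕ) : ℕ := N + 3 * Wq P N + Ly P N + 2 + i
/-- The number of data wires of the clean block: input, query registers, layer, copy, mode. [folklore] -/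
def D : ℕ := N + 3 * Wq P N + Ly P N + 4
/-- The tableau input length of the clean block (data plus the suffix `vg N`). [folklore] -/
def nT : ℕ := D P N + (CWrap.vg N).length
/-- The emptiness wire of output cell `j` of the clean block. [folklore] -/
def eW (j : ℕ) : ℕ := resW P.e P.M (nT P N) j none
/-- The width of the clean block. [folklore] -/
def Wblk : ℕ := width P.e P.M (nT P N)
/-- Mask bit `t` (above the block): query wire `t` is active. [folklore] -/
def MW (t : ℕ) : ℕ := Wblk P N + t
/-- Mask bit `j` (above the block): Hadamard layer `j` is active. [folklore] -/
def KW (j : ℕ) : ℕ := Wblk P N + Wq P N + j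
/-- The control ancilla of the controlled Hadamard gates. [folklore] -/
def aW : ℕ := Wblk P N + Wq P N + Ly P N + 1
/-- The answer flag. [folklore] -/
def oW : ℕ := Wblk P N + Wq P N + Ly P N + 2
/-- The number of wires of the circuit. [folklore] -/
def TWv : ℕ := Wblk P N + Wq P N + Ly P N + 3
/-- The number of ancillas. [folklore] -/
def anc : ℕ := TWv P N - N
/-- The number of wires of the circuit in the form `N + anc N`. [folklore] -/
abbrev TW : ℕ := N + anc P N

/-- `nT = D + 2N + 2`. [folklore] -/
theorem nT_eq : nT P N = D P N + (2 * N + 2) := by simp [nT]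

/-- `D ≤ nT`. [folklore] -/
theorem D_le_nT : D P N ≤ nT P N := Nat.le_add_right _ _

/-- `nT ≤ NN`. [folklore] -/
theorem nT_le_NN : nT P N ≤ NN P.e P.M (nT P N) := le_NN _

/-- `n < JJ n`: there are more represented output cells than tableau inputs. [folklore] -/
theorem lt_JJ (n : ℕ) : n < JJ P.e P.M n := by
  have := one_le_dd P.M.tm
  unfold JJ Sn; nlinarith

/-- The indices of the emptiness wires that are read are represented cells. [folklore] -/
theorem lt_JJ_of_lt_D {j : ℕ} (hj : j < D P N) : j < JJ P.e P.M (nT P N) :=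
  lt_trans (lt_of_lt_of_le hj (D_le_nT P N)) (lt_JJ P _)

/-- `D ≤ Wblk`. [folklore] -/
theorem D_le_Wblk : D P N ≤ Wblk P N := le_trans (D_le_nT P N) (le_trans (nT_le_NN P N) (NN_le_width _))

/-- `TW = TWv`. [folklore] -/
theorem TW_eq : TW P N = TWv P N := by
  have := D_le_Wblk P N; unfold TW anc TWv; unfold D at this; omega

/-- `Wblk + Wq + Ly + 3 = TW`. [folklore] -/
theorem TW_eq' : TW P N = Wblk P N + Wq P N + Ly P N + 3 := TW_eq P N

/-- `0 < TW`. [folklore] -/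
theorem TW_pos : 0 < TW P N := by rw [TW_eq']; omega

/-- `D ≤ TW`. [folklore] -/
theorem D_le_TW : D P N ≤ TW P N := by rw [TW_eq']; have := D_le_Wblk P N; omega

/-- `Wblk < TW`. [folklore] -/
theorem Wblk_lt_TW : Wblk P N < TW P N := by rw [TW_eq']; omega

/-- The emptiness wires lie beyond the data … [folklore] -/
theorem D_le_eW (j : ℕ) : D P N ≤ eW P N j :=
  le_trans (D_le_nT P N) (le_trans (nT_le_NN P N) (NN_le_resW _ _ _))

/-- … and inside the block, for represented cells. [folklore] -/
theorem eW_lt_Wblk {j : ℕ} (hj : j < D P N) : eW P N j < Wblk P N := resW_lt_width (lt_JJ_of_lt_D P N hj) _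

/-- `eW` is injective. [folklore] -/
theorem eW_inj {j j' : ℕ} (h : eW P N j = eW P N j') : j = j' := (resW_inj h).1

/-- Query wires are below the layer register. [folklore] -/
theorem qW_lt {c t : ℕ} (hc : c < 3) (ht : t < Wq P N) : qW P N c t < N + 3 * Wq P N := by
  unfold qW; nlinarith
/-- Query wires are at least `N`. [folklore] -/
theorem N_le_qW (c t : ℕ) : N ≤ qW P N c t := by unfold qW; omega
/-- `qW` is injective. [folklore] -/
theorem qW_inj {c t c' t' : ℕ} (ht : t < Wq P N) (ht' : t' < Wq P N) (h : qW P N c t = qW P N c' t') :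
    c = c' ∧ t = t' := by
  unfold qW at h
  have h1 : c * Wq P N + t = c' * Wq P N + t' := by omega
  have hc : c = c' := by
    rcases lt_trichotomy c c' with hlt | heq | hgt
    · exfalso
      have : (c + 1) * Wq P N ≤ c' * Wq P N := Nat.mul_le_mul_right _ hlt
      nlinarith
    · exact heq
    · exfalso
      have : (c' + 1) * Wq P N ≤ c * Wq P N := Nat.mul_le_mul_right _ hgt
      nlinarith
  subst hc
  exact ⟨rfl, by omega⟩
/-- The positions of the data registers, unfolded (for `omega`). [folklore] -/
theorem data_pos (i : ℕ) : jW P N i = N + 3 * Wq P N + i ∧ cw P N i = N + 3 * Wq P N + Ly P N + i ∧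
    mw P N i = N + 3 * Wq P N + Ly P N + 2 + i ∧ D P N = N + 3 * Wq P N + Ly P N + 4 := ⟨rfl, rfl, rfl, rfl⟩
/-- The positions above the block, unfolded (for `omega`). [folklore] -/
theorem top_pos (i : ℕ) : MW P N i = Wblk P N + i ∧ KW P N i = Wblk P N + Wq P N + i ∧
    aW P N = Wblk P N + Wq P N + Ly P N + 1 ∧ oW P N = Wblk P N + Wq P N + Ly P N + 2 ∧
    TW P N = Wblk P N + Wq P N + Ly P N + 3 := ⟨rfl, rfl, rfl, rfl, TW_eq' P N⟩

end Layout

/-! ### The program -/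

section Program

variable (N : ℕ)

/-- **The clean block** computing `Fn` on the `D N` data wires with suffix `vg N`.
[cite: NielsenChuang2010, §3.2.5] -/
def blkC : List (ClOp ℕ) := cleanOps P.e P.M (D P N) (CWrap.vg N)

/-- The pairs (emptiness wire of cell `t`, wire-mask bit `t`), `t < Wq`. [folklore] -/
def pairsM : List (ℕ × ℕ) := (List.range (Wq P N)).map fun t => (eW P N t, MW P N t)

/-- The pairs (emptiness wire of cell `j`, layer-mask bit `j`), `j ≤ Ly`. [folklore] -/
def pairsK : List (ℕ × ℕ) := (List.range (Ly P N + 1)).map fun j => (eW P N j, KW P N j)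

/-- Negate the wire mask (emptiness `[W ≤ t]` becomes activity `[t < W]`). [folklore] -/
def notsM : List (ClOp ℕ) := (List.range (Wq P N)).map fun t => ClOp.not (MW P N t)

/-- Negate the layer mask. [folklore] -/
def notsK : List (ClOp ℕ) := (List.range (Ly P N + 1)).map fun j => ClOp.not (KW P N j)

/-- **The mask stage** (classical): mode `W`, block, copy, block; mode `K`, block, copy, block;
negate. [cite: BernsteinVazirani1997, §8] -/
def preC : List (ClOp ℕ) :=
  blkC P N ++ copyOps (pairsM P N) ++ blkC P N ++ [ClOp.not (mw P N 0)] ++ blkC P N ++ copyOps (pairsK P N) ++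
    blkC P N ++ [ClOp.not (mw P N 0)] ++ notsM P N ++ notsK P N

/-- The mask stage as `RtOp`s. [folklore] -/
def pre : List (RtOp ℕ) := (preC P N).map RtOp.cl

/-- The masked controlled Hadamard on query wire `t` of copy `c` in layer `j`. [cite: NielsenChuang2010, §4.3] -/
def hGad (j c t : ℕ) : List (RtOp ℕ) :=
  [RtOp.cl (ClOp.toffoli (KW P N j) (MW P N t) (aW P N)), RtOp.chad (aW P N) (qW P N c t),
    RtOp.cl (ClOp.toffoli (KW P N j) (MW P N t) (aW P N))]

/-- **Hadamard layer `j`** on the three copies. [cite: AaronsonAmbainis2018, §3.2 (Fig. 2)] -/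
def hLayer (j : ℕ) : List (RtOp ℕ) :=
  (List.range 3).flatMap fun c => (List.range (Wq P N)).flatMap fun t => hGad P N j c t

/-- Write `1^j` on the layer register. [folklore] -/
def xsJ (j : ℕ) : List (ClOp ℕ) := (List.range j).map fun i => ClOp.not (jW P N i)

/-- Write the code of copy `c` (`0 ↦ 00`, `1 ↦ 10`, `2 ↦ 01`). [folklore] -/
def xsC (c : ℕ) : List (ClOp ℕ) :=
  if c = 1 then [ClOp.not (cw P N 0)] else if c = 2 then [ClOp.not (cw P N 1)] else []

/-- The classical opening of the phase macro: write layer, copy and mode `P`, then the block. [folklore] -/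
def pOpen (j c : ℕ) : List (ClOp ℕ) := xsJ P N j ++ xsC P N c ++ [ClOp.not (mw P N 1)] ++ blkC P N

/-- The classical closing of the phase macro: the block, then unwrite. [folklore] -/
def pClose (j c : ℕ) : List (ClOp ℕ) := blkC P N ++ [ClOp.not (mw P N 1)] ++ xsC P N c ++ xsJ P N j

/-- **The phase macro of layer `j` on copy `c`**: opening, `Z` on the emptiness wire of cell `0`,
closing. [cite: NielsenChuang2010, §6.1.1 (phase oracle from a bit oracle)] -/
def pMacro (j c : ℕ) : List (RtOp ℕ) :=
  (pOpen P N j c).map RtOp.cl ++ zOps (eW P N 0) ++ (pClose P N j c).map RtOp.cl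

/-- The three phase macros of layer `j`. [cite: AaronsonAmbainis2018, §3.2 (Fig. 2)] -/
def pLayer (j : ℕ) : List (RtOp ℕ) := pMacro P N j 0 ++ pMacro P N j 1 ++ pMacro P N j 2

/-- **The zero test and read-out** (classical): mode `Z`, block, `oW := ¬ emptiness₀`, block,
unmode, swap of `oW` with wire `0`. [cite: AaronsonAmbainis2018, §6 (p. 26: test for the all-zero state)] -/
def postC : List (ClOp ℕ) :=
  [ClOp.not (mw P N 0), ClOp.not (mw P N 1)] ++ blkC P N ++ [ClOp.cnot (eW P N 0) (oW P N), ClOp.not (oW P N)] ++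
    blkC P N ++ [ClOp.not (mw P N 0), ClOp.not (mw P N 1)] ++
      [ClOp.cnot (oW P N) 0, ClOp.cnot 0 (oW P N), ClOp.cnot (oW P N) 0]

/-- The zero test and read-out as `RtOp`s. [folklore] -/
def post : List (RtOp ℕ) := (postC P N).map RtOp.cl

/-- The layer loop: Hadamard layer `j` then the phase macros of layer `j + 1`, for `j < Ly`. [cite: AaronsonAmbainis2018, §3.2 (Fig. 2)] -/
def layers : List (RtOp ℕ) := (List.range (Ly P N)).flatMap fun j => hLayer P N j ++ pLayer P N (j + 1)

/-- **The whole program.** [cite: AaronsonAmbainis2018, §6 (p. 26) and §3.2 (Fig. 2)] -/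
def allOps : List (RtOp ℕ) := pre P N ++ layers P N ++ hLayer P N (Ly P N) ++ post P N

end Program

/-! ### Well-formedness and wire bounds -/

section Bounds

variable (N : ℕ)

/-- A program of classical operations as `RtOp`s is well formed iff the operations are. [folklore] -/
theorem wf_map_cl {ops : List (ClOp ℕ)} (h : ∀ op ∈ ops, op.WF) : ∀ op ∈ ops.map RtOp.cl, op.WF := by
  intro op hop
  obtain ⟨op', hop', rfl⟩ := List.mem_map.1 hop
  exact h op' hop'

/-- Wires of a program of classical operations as `RtOp`s. [folklore] -/
theorem lt_map_cl {ops : List (ClOp ℕ)} {B : ℕ} (h : ∀ op ∈ ops, ∀ i ∈ wiresOf op, i < B) :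
    ∀ op ∈ ops.map RtOp.cl, ∀ w ∈ op.wires, w < B := by
  intro op hop w hw
  obtain ⟨op', hop', rfl⟩ := List.mem_map.1 hop
  exact h op' hop' w hw

/-- The wires of a singleton classical `RtOp` are the wires of the operation. [folklore] -/
theorem wires_cl (op : ClOp ℕ) : (RtOp.cl op).wires = wiresOf op := rfl

/-- The block is well formed. [folklore] -/
theorem blkC_wf : ∀ op ∈ blkC P N, op.WF := cleanOps_wf

/-- The block stays inside the block width. [folklore] -/
theorem blkC_lt_Wblk : ∀ op ∈ blkC P N, ∀ w ∈ wiresOf op, w < Wblk P N := by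
  intro op hop i hi
  have := cleanOps_lt op hop i hi
  simpa [Wblk, nT] using this

/-- The block stays inside the register. [folklore] -/
theorem blkC_lt : ∀ op ∈ blkC P N, ∀ w ∈ wiresOf op, w < TW P N :=
  fun op hop w hw => lt_trans (blkC_lt_Wblk P N op hop w hw) (Wblk_lt_TW P N)

/-- Every wire of the data is inside the register. [folklore] -/
theorem lt_TW_of_lt_D {w : ℕ} (hw : w < D P N) : w < TW P N := lt_of_lt_of_le hw (D_le_TW P N)

/-- The mode wires are data. [folklore] -/
theorem mw_lt_D {i : ℕ} (hi : i < 2) : mw P N i < D P N := by unfold mw D; omega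

/-- The copy wires are data. [folklore] -/
theorem cw_lt_D {i : ℕ} (hi : i < 2) : cw P N i < D P N := by unfold cw D; omega

/-- The layer wires are data. [folklore] -/
theorem jW_lt_D {i : ℕ} (hi : i < Ly P N) : jW P N i < D P N := by unfold jW D; omega

/-- The query wires are data. [folklore] -/
theorem qW_lt_D {c t : ℕ} (hc : c < 3) (ht : t < Wq P N) : qW P N c t < D P N := by
  have := qW_lt P N hc ht; unfold D; omega

/-- The wires above the block are inside the register. [folklore] -/
theorem top_lt {w : ℕ} (hw : w < Wblk P N + Wq P N + Ly P N + 3) : w < TW P N := by rwa [TW_eq']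

/-- `preC` is well formed. [folklore] -/
theorem preC_wf : ∀ op ∈ preC P N, op.WF := by
  have hb : ∀ op ∈ blkC P N, op.WF := cleanOps_wf
  intro op hop
  simp only [preC, List.mem_append, List.mem_singleton] at hop
  rcases hop with ((((((((h | h) | h) | rfl) | h) | h) | h) | rfl) | h) | h
  · exact hb op h
  · refine copyOps_wf (fun p hp => ?_) op h
    simp only [pairsM, List.mem_map, List.mem_range] at hp
    obtain ⟨t, ht, rfl⟩ := hp
    have := eW_lt_Wblk P N (j := t) (by unfold D; omega); change eW P N t ≠ MW P N t; unfold MW; omega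
  · exact hb op h
  · trivial
  · exact hb op h
  · refine copyOps_wf (fun p hp => ?_) op h
    simp only [pairsK, List.mem_map, List.mem_range] at hp
    obtain ⟨j, hj, rfl⟩ := hp
    have := eW_lt_Wblk P N (j := j) (by unfold D Ly; unfold Ly at hj; omega); change eW P N j ≠ KW P N j; unfold KW; omega
  · exact hb op h
  · trivial
  · simp only [notsM, List.mem_map] at h; obtain ⟨t, -, rfl⟩ := h; trivial
  · simp only [notsK, List.mem_map] at h; obtain ⟨j, -, rfl⟩ := h; trivial

/-- `preC` stays inside the register. [folklore] -/
theorem preC_lt : ∀ op ∈ preC P N, ∀ w ∈ wiresOf op, w < TW P N := by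
  have hb : ∀ op ∈ blkC P N, ∀ w ∈ wiresOf op, w < TW P N :=
    fun op hop w hw => lt_trans (by simpa [Wblk, nT] using cleanOps_lt op hop w hw) (Wblk_lt_TW P N)
  have hm0 : mw P N 0 < TW P N := lt_TW_of_lt_D P N (mw_lt_D P N Nat.zero_lt_two)
  intro op hop w hw
  simp only [preC, List.mem_append, List.mem_singleton] at hop
  rcases hop with ((((((((h | h) | h) | rfl) | h) | h) | h) | rfl) | h) | h
  · exact hb op h w hw
  · obtain ⟨p, hp, rfl⟩ := mem_copyOps.1 h
    simp only [pairsM, List.mem_map, List.mem_range] at hp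
    obtain ⟨t, ht, rfl⟩ := hp
    simp only [mem_wiresOf, ClOp.target, ClOp.controls, List.mem_singleton] at hw
    rcases hw with rfl | rfl
    · exact top_lt P N (by unfold MW; omega)
    · exact lt_trans (eW_lt_Wblk P N (by unfold D; omega)) (Wblk_lt_TW P N)
  · exact hb op h w hw
  · simp only [mem_wiresOf, ClOp.target, ClOp.controls, List.not_mem_nil, or_false] at hw
    subst hw; exact hm0
  · exact hb op h w hw
  · obtain ⟨p, hp, rfl⟩ := mem_copyOps.1 h
    simp only [pairsK, List.mem_map, List.mem_range] at hp
    obtain ⟨j, hj, rfl⟩ := hp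
    simp only [mem_wiresOf, ClOp.target, ClOp.controls, List.mem_singleton] at hw
    rcases hw with rfl | rfl
    · exact top_lt P N (by unfold KW; omega)
    · exact lt_trans (eW_lt_Wblk P N (by unfold D Ly; unfold Ly at hj; omega)) (Wblk_lt_TW P N)
  · exact hb op h w hw
  · simp only [mem_wiresOf, ClOp.target, ClOp.controls, List.not_mem_nil, or_false] at hw
    subst hw; exact hm0
  · simp only [notsM, List.mem_map, List.mem_range] at h
    obtain ⟨t, ht, rfl⟩ := h
    simp only [mem_wiresOf, ClOp.target, ClOp.controls, List.not_mem_nil, or_false] at hw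
    subst hw; exact top_lt P N (by unfold MW; omega)
  · simp only [notsK, List.mem_map, List.mem_range] at h
    obtain ⟨j, hj, rfl⟩ := h
    simp only [mem_wiresOf, ClOp.target, ClOp.controls, List.not_mem_nil, or_false] at hw
    subst hw; exact top_lt P N (by unfold KW; omega)

/-- `pre` is well formed. [folklore] -/
theorem pre_wf : ∀ op ∈ pre P N, op.WF := wf_map_cl (preC_wf P N)

/-- `pre` stays inside the register. [folklore] -/
theorem pre_lt : ∀ op ∈ pre P N, ∀ w ∈ op.wires, w < TW P N := lt_map_cl (preC_lt P N)

/-- `hGad` is well formed. [folklore] -/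
theorem hGad_wf {j c t : ℕ} (hj : j < Ly P N + 1) (hc : c < 3) (ht : t < Wq P N) : ∀ op ∈ hGad P N j c t, op.WF := by
  have h5 := qW_lt_D P N hc ht; have h6 := D_le_Wblk P N
  intro op hop
  simp only [hGad, List.mem_cons, List.not_mem_nil, or_false] at hop
  rcases hop with rfl | rfl | rfl
  · refine ⟨?_, ?_, ?_⟩ <;> simp only [KW, MW, aW, ne_eq] <;> omega
  · change aW P N ≠ qW P N c t
    unfold aW; omega
  · refine ⟨?_, ?_, ?_⟩ <;> simp only [KW, MW, aW, ne_eq] <;> omega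

/-- `hGad` stays inside the register. [folklore] -/
theorem hGad_lt {j c t : ℕ} (hj : j < Ly P N + 1) (hc : c < 3) (ht : t < Wq P N) :
    ∀ op ∈ hGad P N j c t, ∀ w ∈ op.wires, w < TW P N := by
  have hq := lt_TW_of_lt_D P N (qW_lt_D P N hc ht)
  have hK : KW P N j < TW P N := top_lt P N (by unfold KW; omega)
  have hM : MW P N t < TW P N := top_lt P N (by unfold MW; omega)
  have ha : aW P N < TW P N := top_lt P N (by unfold aW; omega)
  intro op hop w hw
  simp only [hGad, List.mem_cons, List.not_mem_nil, or_false] at hop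
  rcases hop with rfl | rfl | rfl
  · simp only [wires_cl, mem_wiresOf, ClOp.target, ClOp.controls, List.mem_cons, List.not_mem_nil, or_false] at hw
    rcases hw with rfl | rfl | rfl <;> assumption
  · simp only [RtOp.wires, List.mem_cons, List.not_mem_nil, or_false] at hw
    rcases hw with rfl | rfl <;> assumption
  · simp only [wires_cl, mem_wiresOf, ClOp.target, ClOp.controls, List.mem_cons, List.not_mem_nil, or_false] at hw
    rcases hw with rfl | rfl | rfl <;> assumption

/-- `hLayer` is well formed. [folklore] -/
theorem hLayer_wf {j : ℕ} (hj : j < Ly P N + 1) : ∀ op ∈ hLayer P N j, op.WF := by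
  intro op hop
  simp only [hLayer, List.mem_flatMap, List.mem_range] at hop
  obtain ⟨c, hc, t, ht, hop⟩ := hop
  exact hGad_wf P N hj hc ht op hop

/-- `hLayer` stays inside the register. [folklore] -/
theorem hLayer_lt {j : ℕ} (hj : j < Ly P N + 1) : ∀ op ∈ hLayer P N j, ∀ w ∈ op.wires, w < TW P N := by
  intro op hop
  simp only [hLayer, List.mem_flatMap, List.mem_range] at hop
  obtain ⟨c, hc, t, ht, hop⟩ := hop
  exact hGad_lt P N hj hc ht op hop

/-- `xsJ` is well formed. [folklore] -/
theorem xsJ_wf (j : ℕ) : ∀ op ∈ xsJ P N j, op.WF := by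
  intro op hop; simp only [xsJ, List.mem_map] at hop; obtain ⟨i, -, rfl⟩ := hop; trivial

/-- `xsJ` stays inside the data. [folklore] -/
theorem xsJ_lt_D {j : ℕ} (hj : j ≤ Ly P N) : ∀ op ∈ xsJ P N j, ∀ w ∈ wiresOf op, w < D P N := by
  intro op hop w hw
  simp only [xsJ, List.mem_map, List.mem_range] at hop
  obtain ⟨i, hi, rfl⟩ := hop
  simp only [mem_wiresOf, ClOp.target, ClOp.controls, List.not_mem_nil, or_false] at hw
  subst hw
  exact jW_lt_D P N (by omega)

/-- `xsC` is well formed. [folklore] -/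
theorem xsC_wf (c : ℕ) : ∀ op ∈ xsC P N c, op.WF := by
  intro op hop; unfold xsC at hop; split_ifs at hop <;> simp at hop <;> subst hop <;> trivial

/-- `xsC` stays inside the data. [folklore] -/
theorem xsC_lt_D (c : ℕ) : ∀ op ∈ xsC P N c, ∀ w ∈ wiresOf op, w < D P N := by
  intro op hop w hw
  unfold xsC at hop
  split_ifs at hop <;> simp at hop <;> subst hop <;>
    simp only [mem_wiresOf, ClOp.target, ClOp.controls, List.not_mem_nil, or_false] at hw <;>
    subst hw
  · exact cw_lt_D P N Nat.zero_lt_two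
  · exact cw_lt_D P N Nat.one_lt_two

/-- `pOpen` is well formed. [folklore] -/
theorem pOpen_wf (j c : ℕ) : ∀ op ∈ pOpen P N j c, op.WF := by
  intro op hop
  simp only [pOpen, List.mem_append, List.mem_singleton] at hop
  rcases hop with ((h | h) | rfl) | h
  · exact xsJ_wf P N j op h
  · exact xsC_wf P N c op h
  · trivial
  · exact cleanOps_wf op h

/-- `pClose` is well formed. [folklore] -/
theorem pClose_wf (j c : ℕ) : ∀ op ∈ pClose P N j c, op.WF := by
  intro op hop
  simp only [pClose, List.mem_append, List.mem_singleton] at hop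
  rcases hop with ((h | rfl) | h) | h
  · exact cleanOps_wf op h
  · trivial
  · exact xsC_wf P N c op h
  · exact xsJ_wf P N j op h

/-- `pOpen` stays inside the block. [folklore] -/
theorem pOpen_lt {j : ℕ} (hj : j ≤ Ly P N) (c : ℕ) : ∀ op ∈ pOpen P N j c, ∀ w ∈ wiresOf op, w < Wblk P N := by
  have hD := D_le_Wblk P N
  intro op hop w hw
  simp only [pOpen, List.mem_append, List.mem_singleton] at hop
  rcases hop with ((h | h) | rfl) | h
  · exact lt_of_lt_of_le (xsJ_lt_D P N hj op h w hw) hD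
  · exact lt_of_lt_of_le (xsC_lt_D P N c op h w hw) hD
  · simp only [mem_wiresOf, ClOp.target, ClOp.controls, List.not_mem_nil, or_false] at hw
    subst hw; exact lt_of_lt_of_le (mw_lt_D P N Nat.one_lt_two) hD
  · simpa [Wblk, nT] using cleanOps_lt op h w hw

/-- `pClose` stays inside the block. [folklore] -/
theorem pClose_lt {j : ℕ} (hj : j ≤ Ly P N) (c : ℕ) : ∀ op ∈ pClose P N j c, ∀ w ∈ wiresOf op, w < Wblk P N := by
  have hD := D_le_Wblk P N
  intro op hop w hw
  simp only [pClose, List.mem_append, List.mem_singleton] at hop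
  rcases hop with ((h | rfl) | h) | h
  · simpa [Wblk, nT] using cleanOps_lt op h w hw
  · simp only [mem_wiresOf, ClOp.target, ClOp.controls, List.not_mem_nil, or_false] at hw
    subst hw; exact lt_of_lt_of_le (mw_lt_D P N Nat.one_lt_two) hD
  · exact lt_of_lt_of_le (xsC_lt_D P N c op h w hw) hD
  · exact lt_of_lt_of_le (xsJ_lt_D P N hj op h w hw) hD

/-- `pMacro` is well formed. [folklore] -/
theorem pMacro_wf (j c : ℕ) : ∀ op ∈ pMacro P N j c, op.WF := by
  intro op hop
  simp only [pMacro, List.mem_append] at hop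
  rcases hop with (h | h) | h
  · exact wf_map_cl (pOpen_wf P N j c) op h
  · exact zOps_wf _ op h
  · exact wf_map_cl (pClose_wf P N j c) op h

/-- `pMacro` stays inside the block. [folklore] -/
theorem pMacro_lt_Wblk {j : ℕ} (hj : j ≤ Ly P N) (c : ℕ) : ∀ op ∈ pMacro P N j c, ∀ w ∈ op.wires, w < Wblk P N := by
  intro op hop
  simp only [pMacro, List.mem_append] at hop
  rcases hop with (h | h) | h
  · exact lt_map_cl (pOpen_lt P N hj c) op h
  · intro w hw; rw [zOps_wires _ op h w hw]; exact eW_lt_Wblk P N (by unfold D; omega)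
  · exact lt_map_cl (pClose_lt P N hj c) op h

/-- `pMacro` stays inside the register. [folklore] -/
theorem pMacro_lt {j : ℕ} (hj : j ≤ Ly P N) (c : ℕ) : ∀ op ∈ pMacro P N j c, ∀ w ∈ op.wires, w < TW P N :=
  fun op hop w hw => lt_trans (pMacro_lt_Wblk P N hj c op hop w hw) (Wblk_lt_TW P N)

/-- `pLayer` is well formed. [folklore] -/
theorem pLayer_wf (j : ℕ) : ∀ op ∈ pLayer P N j, op.WF := by
  intro op hop
  simp only [pLayer, List.mem_append] at hop
  rcases hop with (h | h) | h <;> exact pMacro_wf P N j _ op h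

/-- `pLayer` stays inside the register. [folklore] -/
theorem pLayer_lt {j : ℕ} (hj : j ≤ Ly P N) : ∀ op ∈ pLayer P N j, ∀ w ∈ op.wires, w < TW P N := by
  intro op hop
  simp only [pLayer, List.mem_append] at hop
  rcases hop with (h | h) | h <;> exact pMacro_lt P N hj _ op h

/-- `layers` is well formed. [folklore] -/
theorem layers_wf : ∀ op ∈ layers P N, op.WF := by
  intro op hop
  simp only [layers, List.mem_flatMap, List.mem_range, List.mem_append] at hop
  obtain ⟨j, hj, h | h⟩ := hop
  · exact hLayer_wf P N (by omega) op h
  · exact pLayer_wf P N _ op h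

/-- `layers` stays inside the register. [folklore] -/
theorem layers_lt : ∀ op ∈ layers P N, ∀ w ∈ op.wires, w < TW P N := by
  intro op hop
  simp only [layers, List.mem_flatMap, List.mem_range, List.mem_append] at hop
  obtain ⟨j, hj, h | h⟩ := hop
  · exact hLayer_lt P N (by omega) op h
  · exact pLayer_lt P N (by omega) op h

/-- `postC` is well formed. [folklore] -/
theorem postC_wf : ∀ op ∈ postC P N, op.WF := by
  have he := eW_lt_Wblk P N (j := 0) (by unfold D; omega)
  have h0 : (0 : ℕ) ≠ oW P N := by unfold oW; omega
  intro op hop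
  simp only [postC, List.mem_append, List.mem_cons, List.not_mem_nil, or_false] at hop
  rcases hop with (((((rfl | rfl) | h) | rfl | rfl) | h) | rfl | rfl) | rfl | rfl | rfl
  · trivial
  · trivial
  · exact cleanOps_wf op h
  · change eW P N 0 ≠ oW P N; unfold oW; omega
  · trivial
  · exact cleanOps_wf op h
  · trivial
  · trivial
  · exact h0.symm
  · exact h0
  · exact h0.symm

/-- `postC` stays inside the register. [folklore] -/
theorem postC_lt : ∀ op ∈ postC P N, ∀ w ∈ wiresOf op, w < TW P N := by
  have hT := TW_pos P N
  have ho : oW P N < TW P N := top_lt P N (by unfold oW; omega)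
  have he : eW P N 0 < TW P N := lt_trans (eW_lt_Wblk P N (by unfold D; omega)) (Wblk_lt_TW P N)
  have hm : ∀ i, i < 2 → mw P N i < TW P N := fun i hi => lt_TW_of_lt_D P N (mw_lt_D P N hi)
  have hb : ∀ op ∈ blkC P N, ∀ w ∈ wiresOf op, w < TW P N :=
    fun op hop w hw => lt_trans (by simpa [Wblk, nT] using cleanOps_lt op hop w hw) (Wblk_lt_TW P N)
  intro op hop w hw
  simp only [postC, List.mem_append, List.mem_cons, List.not_mem_nil, or_false] at hop
  rcases hop with (((((rfl | rfl) | h) | rfl | rfl) | h) | rfl | rfl) | rfl | rfl | rfl <;>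
    first
    | exact hb op h w hw
    | (simp only [mem_wiresOf, ClOp.target, ClOp.controls, List.mem_cons, List.not_mem_nil, or_false] at hw
       rcases hw with rfl | rfl <;> first | exact hm 0 (by norm_num) | exact hm 1 (by norm_num) | exact ho | exact he | exact hT)

/-- `post` is well formed. [folklore] -/
theorem post_wf : ∀ op ∈ post P N, op.WF := wf_map_cl (postC_wf P N)

/-- `post` stays inside the register. [folklore] -/
theorem post_lt : ∀ op ∈ post P N, ∀ w ∈ op.wires, w < TW P N := lt_map_cl (postC_lt P N)

/-- **The whole program is well formed.** [folklore] -/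
theorem allOps_wf : ∀ op ∈ allOps P N, op.WF := by
  intro op hop
  simp only [allOps, List.mem_append] at hop
  rcases hop with ((h | h) | h) | h
  · exact pre_wf P N op h
  · exact layers_wf P N op h
  · exact hLayer_wf P N (Nat.lt_succ_self _) op h
  · exact post_wf P N op h

/-- **The whole program stays inside the register.** [folklore] -/
theorem allOps_lt : ∀ op ∈ allOps P N, ∀ w ∈ op.wires, w < TW P N := by
  intro op hop
  simp only [allOps, List.mem_append] at hop
  rcases hop with ((h | h) | h) | h
  · exact pre_lt P N op h
  · exact layers_lt P N op h
  · exact hLayer_lt P N (Nat.lt_succ_self _) op h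
  · exact post_lt P N op h

/-- The program has no oracle queries. [folklore] -/
theorem allOps_noOracle : ∀ op ∈ allOps P N, ∀ qs t, op ≠ RtOp.oracle qs t := by
  intro op hop qs t h
  subst h
  simp only [allOps, pre, layers, post, hLayer, pLayer, pMacro, hGad, zOps,
    List.mem_append, List.mem_flatMap, List.mem_map, List.mem_cons, List.mem_range, List.not_mem_nil,
    reduceCtorEq, and_false, exists_false, or_self] at hop

end Bounds

/-! ### The circuit and the family -/

section Circuit

variable (N : ℕ)

/-- Wires of the register through `finOf`. [folklore] -/
def foW : ℕ → Fin (TW P N) := finOf (TW P N) (TW_pos P N)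

/-- **The circuit at input length `N`.** [cite: AaronsonAmbainis2018, §6 (p. 26)] -/
def bigCirc : QCircuit cliffordT (TW P N) :=
  ⟨RtOp.compileList ((allOps P N).map (RtOp.map (foW P N))) (wf_map_finOf_of (TW_pos P N) (allOps_wf P N) (allOps_lt P N))⟩

/-- **The phase-query family.** [cite: AaronsonAmbainis2018, §6 (p. 26)] -/
def family : QCircuitFamily cliffordT where
  ancillas := anc P
  circ := bigCirc P

/-- A compiled non-oracle operation is oracle-free. [folklore] -/
theorem compile_isOracleFree {W : ℕ} (op : RtOp (Fin W)) (h : op.WF) (hno : ∀ qs t, op ≠ RtOp.oracle qs t) :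
    ∀ g ∈ op.compile h, g.IsOracleFree := by
  cases op with
  | cl op => exact RevOp.compile_isOracleFree _
  | had a => intro g hg; simp [RtOp.compile] at hg; subst hg; exact hOn_isOracleFree _
  | chad c a => exact chWord_isOracleFree _ _ _
  | oracle qs t => exact absurd rfl (hno qs t)

/-- A compiled program without oracle operations is oracle-free. [folklore] -/
theorem compileList_isOracleFree {W : ℕ} : ∀ (ops : List (RtOp (Fin W))) (h : ∀ op ∈ ops, op.WF)
    (_ : ∀ op ∈ ops, ∀ qs t, op ≠ RtOp.oracle qs t), ∀ g ∈ RtOp.compileList ops h, g.IsOracleFree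
  | [], _, _ => by simp [RtOp.compileList]
  | op :: ops, h, hno => by
    intro g hg
    rw [RtOp.compileList_cons, List.mem_append] at hg
    rcases hg with hg | hg
    · exact compile_isOracleFree op _ (hno op (by simp)) g hg
    · exact compileList_isOracleFree ops _ (fun o ho => hno o (by simp [ho])) g hg

/-- The circuit is oracle-free. [folklore] -/
theorem bigCirc_isOracleFree : (bigCirc P N).IsOracleFree := by
  unfold bigCirc QCircuit.IsOracleFree
  apply compileList_isOracleFree
  intro op hop qs t h
  obtain ⟨op', hop', rfl⟩ := List.mem_map.1 hop
  cases op' with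
  | oracle qs' t' => exact allOps_noOracle P N _ hop' qs' t' rfl
  | _ => simp [RtOp.map] at h

/-- **The family is oracle-free.** [folklore] -/
theorem family_isOracleFree : (family P).IsOracleFree := fun N => bigCirc_isOracleFree P N

end Circuit

end PhaseQuery

end Literature.Computability.QuantumComplexity
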